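import Literature.Computability.AlgebraicComplexity.AlgDetRepr
import Literature.Computability.AlgebraicComplexity.LayeredABPInvRepr
import HarnessLib

/-!
# Read-outs: determinantal representations and layered ABPs OVER a coefficient algebra are
# `(m, s)`-representations

Helper file for the crux `AbelianizationQP` (stmt-ValiantsHypothesis-8063) and the piece
`PolySizeQPAlgebra` (stmt-8064) of route `GrenetZeon`.  The constructive side of the crux builds
representations of `per_n` by computing a polynomial `F` with coefficients in a commutative
algebra `R` (zeons, apolar algebras, tensor factors of such) and reading one coordinate
`f = λ_* F`.  This file records the two bridges that turn such computations into
`(m, s)`-representations, so that the tree's machinery for affine determinantal representations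
and layered algebraic branching programs over an ARBITRARY commutative ring
(`HasDetRepr`, `LayeredABPComputes.hasDetRepr` — Valiant 1979 / Bürgisser–Clausen–Shokrollahi
Thm. 21.27, in `LayeredABPInvRepr.lean`) can be run over the coefficient algebra itself:

* `hasAlgDetRepr_of_hasDetRepr_readOut` — `HasDetRepr F m` over `R` (`dim_k R ≤ s`) and
  `λ (coeff_d F) = coeff_d f` give `HasAlgDetRepr f m s`;
* `hasAlgDetRepr_of_layeredABP_readOut` — a layered ABP on `≤ m` vertices with affine labels over
  `R` computing `F`, read through `λ`, gives `HasAlgDetRepr f (m + 1) s`.  This is the shell of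
  every «partial de-algebraization» / hybrid construction (run a width-`w`, length-`d` program over a
  `2^b`-dimensional zeon factor: an `((d + 1) w + 1, 2^b)`-representation), the route by which
  tradeoff points between the zeon point `(n, 2^n)` and Grenet's `(2^n - 1, 1)` are to be built.

This file is route-independent (no `Theses` import).  No stub is closed; `VP ≠ VNP` is not
touched.

## References

* L. G. Valiant, *Completeness classes in algebra*, STOC 1979, §2. [cite: Valiant1979, §2]
* P. Hrubeš, A. Yehudayoff, *Arithmetic complexity in ring extensions*, Theory of Computing 7
  (2011), §2. [cite: HrubesYehudayoff2011, §2]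
-/

set_option linter.dupNamespace false

noncomputable section

namespace Summit.ValiantsHypothesis.ValiantsHypothesis.Theorems.GrenetZeonPolySizeQPAlgebra

open MvPolynomial Matrix
open Literature.Computability.AlgebraicComplexity

universe u v

section ReadOut

variable {k : Type u} [CommRing k] {σ : Type v}

/-- **Read-out of a determinantal representation over the coefficient algebra.** If `F` (a
polynomial with coefficients in a commutative `k`-algebra `R`, finite of dimension `≤ s`) has an
affine determinantal representation of size `m` OVER `R`, and `f = λ_* F` coefficientwise for a
`k`-linear `λ : R → k`, then `f` has an `(m, s)`-representation. [cite: HrubesYehudayoff2011, §2] -/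
theorem hasAlgDetRepr_of_hasDetRepr_readOut {f : MvPolynomial σ k} {m s : ℕ} (R : Type u)
    [CommRing R] [Algebra k R] [Module.Finite k R] (hR : Module.finrank k R ≤ s)
    (l : R →ₗ[k] k) {F : MvPolynomial σ R} (hF : HasDetRepr F m)
    (hf : ∀ d : σ →₀ ℕ, l (coeff d F) = coeff d f) : HasAlgDetRepr f m s := by
  obtain ⟨A, hA, hdet⟩ := hF
  exact HasAlgDetRepr.of_data R hR l A hA fun d => by rw [hdet, hf]

/-- **Read-out of a layered algebraic branching program over the coefficient algebra.** A layered
ABP on at most `m` vertices with affine edge labels over `R` (`dim_k R ≤ s`) computing `F`, read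
through `λ` (`f = λ_* F`), is an `(m + 1, s)`-representation of `f`
(`LayeredABPComputes.hasDetRepr` over the ring `R`, then `hasAlgDetRepr_of_hasDetRepr_readOut`).
[cite: Valiant1979, §2] -/
theorem hasAlgDetRepr_of_layeredABP_readOut {f : MvPolynomial σ k} {m s : ℕ} (R : Type u)
    [CommRing R] [Algebra k R] [Module.Finite k R] (hR : Module.finrank k R ≤ s)
    (l : R →ₗ[k] k) {F : MvPolynomial σ R} (hF : LayeredABPComputes m F)
    (hf : ∀ d : σ →₀ ℕ, l (coeff d F) = coeff d f) : HasAlgDetRepr f (m + 1) s :=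
  hasAlgDetRepr_of_hasDetRepr_readOut R hR l hF.hasDetRepr hf

/-- The `s = 1` instance over a field: a layered ABP on `≤ m` vertices over `k` itself gives an
`(m + 1, 1)`-representation (read-out `λ = id`). [cite: Valiant1979, §2] -/
theorem hasAlgDetRepr_of_layeredABP {K : Type u} [Field K] {f : MvPolynomial σ K} {m : ℕ}
    (hF : LayeredABPComputes m f) : HasAlgDetRepr f (m + 1) 1 :=
  hasAlgDetRepr_of_layeredABP_readOut K (Module.finrank_self K).le LinearMap.id hF fun _ => rfl

end ReadOut

end Summit.ValiantsHypothesis.ValiantsHypothesis.Theorems.GrenetZeonPolySizeQPAlgebra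

end
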